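import Summits.FinalStateConjecture.FinalStateConjecture.Theses.BondiDrainDispersal
import Summits.FinalStateConjecture.FinalStateConjecture.Theses.TangentProfileCensorship
import Summits.FinalStateConjecture.FinalStateConjecture.Theses.CurvatureOrSymmetry
import Summits.FinalStateConjecture.FinalStateConjecture.Theses.PhaseMixingCapture
import Literature.Geometry.Lorentzian.TameGenericityLocal
import Literature.Geometry.Lorentzian.TameGenericityDiagonal
import Literature.Geometry.Lorentzian.AdmissibleMGHDExistence

/-!
# `GenericCensoredHolesSettle` (stmt-FinalStateConjecture-17285, route BondiDrainDispersal, rank 5):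
# where the crux and the four registered stubs of line `registered` sit in the item lattice

Helper file of the line lead (crux `BondiDrainDispersal.GenericCensoredHolesSettle`; skeleton
`Cruxes/GenericCensoredHolesSettle/Lines/birth.lean`, stubs `stub_mghdExists`,
`stub_weakCosmicCensorship`, `stub_landing`, `stub_thresholdEscape`). Everything here is sorry-free,
definition-free pure logic; the hypotheses are EXISTING route items BY NAME, the Literature named fact
`choquetBruhat_geroch_exists_mghd_cauchy`, or registered stub signatures written out verbatim (the
skeleton itself is a crux workfile and is not importable).

* Crux level. `genericCensoredHolesSettle_of_finalStateConjecture` (the crux is a weakening of the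
  summit: `IsTameChristodoulouGeneric.mono`); `finalStateConjecture_of_censoredHorizonlessDisperse`
  (the rev-3 two-hypothesis form of the route's deciding theorem: this route's rank-3 crux
  `CensoredHorizonlessDisperse` + the crux give the summit), hence
  `genericCensoredHolesSettle_iff_finalStateConjecture` GRANTED `CensoredHorizonlessDisperse`;
  `genericCensoredHolesSettle_of_tameExits` (the crux from the three TangentProfileCensorship /
  CurvatureOrSymmetry items stmt-9937 `MGHDExistence`, stmt-17383 `NakedDataTameExit`, stmt-17348
  `TameCensoredDataExit`, by name).
* Stub level (each registered signature verbatim).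
  - `stub_mghdExists_iff_mghdExistence` (`Iff.rfl` with item stmt-9937) and
    `stub_mghdExists_of_choquetBruhatGeroch` (one line from the CBG named fact);
  - `stub_weakCosmicCensorship_of_weakCosmicCensorshipTame` (from item stmt-17269 by `mono`) and
    `stub_weakCosmicCensorship_of_nakedDataTameExit` (from item stmt-17383 by locality);
  - `stub_landing_of_nakedDataTameExit` (from stmt-17383: ignore the given censored curve);
  - `stub_thresholdEscape_of_tameCensoredDataExit` (from stmt-17348: forget the horizon);
  - conversely, GRANTED this route's `CensoredHorizonlessDisperse` and MGHD existence:
    `tameCensoredDataExit_of_stub_thresholdEscape` and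
    `nakedDataTameExit_of_stub_weakCosmicCensorship_of_stub_landing` — so modulo the route's own
    rank-3 crux and the CBG fact, the line's threshold stub IS item 17348 and its violating-stratum
    pair (stubs 1 + 2) IS item 17383: the genericity branch of BondiDrainDispersal adds no obligation
    beyond the two TangentProfileCensorship exits.

Nothing here is analysis; all genericity / stability content sits in the named hypotheses.
-/

-- the doubled `FinalStateConjecture.FinalStateConjecture` path component trips dupNamespace
set_option linter.dupNamespace false

noncomputable section

open scoped Manifold ContDiff Topology
open Set Function

namespace Summit.FinalStateConjecture.FinalStateConjecture.Theorems.BondiDrainDispersalGenericCensoredHolesSettle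

open Literature.Geometry.Lorentzian
open Summit.FinalStateConjecture.FinalStateConjecture.Theses
open Summit.FinalStateConjecture.FinalStateConjecture.Theses.BondiDrainDispersal
  (GenericCensoredHolesSettle CensoredHorizonlessDisperse)

/-! ## §1 Crux level -/

/-- **The crux is a weakening of the summit**: `FinalStateConjecture → GenericCensoredHolesSettle`
(drop the horizon hypothesis of the decomposition conjunct; tame genericity is monotone in the
property, `IsTameChristodoulouGeneric.mono`). [folklore] -/
theorem genericCensoredHolesSettle_of_finalStateConjecture (h : _root_.FinalStateConjecture) :
    GenericCensoredHolesSettle := by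
  intro X _ _ _ _ _ _
  exact (h X).mono fun D _ hP ↦ ⟨hP.1, fun 𝒟 h𝒟 ↦ ⟨(hP.2 𝒟 h𝒟).1, fun _ ↦ (hP.2 𝒟 h𝒟).2⟩⟩

/-- **The rev-3 two-hypothesis deciding argument of the route**: this route's rank-3 crux
`CensoredHorizonlessDisperse` (censored horizonless MGHDs disperse honestly) and the generic branch
`GenericCensoredHolesSettle` give the summit — case split on the ray-theoretic horizon, `Fin.elim0`
for sub-extremality at `N = 0`, and monotonicity of tame genericity (the same end and the same tame
immersed injective admissible family serve). Re-proved here because the route file's `closes` is in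
leaf form over `HorizonlessMustDrain`/`DrainImpliesDisperse`. [folklore] -/
theorem finalStateConjecture_of_censoredHorizonlessDisperse (hA : CensoredHorizonlessDisperse)
    (hG : GenericCensoredHolesSettle) : _root_.FinalStateConjecture := by
  intro X _ _ _ _ _ _
  refine (hG X).mono fun D hD h ↦ ⟨h.1, fun 𝒟 h𝒟 ↦ ⟨(h.2 𝒟 h𝒟).1, ?_⟩⟩
  by_cases hH : (∀ [𝒟.metric.HasLeviCivita], ∃ q : 𝒟.carrier, ∀ (p : X) (γ : ℝ → 𝒟.carrier)
      (dom : Set ℝ), 𝒟.metric.IsNormalisedNullRayFrom 𝒟.timeOrientation 𝒟.embed 𝒟.normal p γ dom →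
      ¬ BddAbove dom → q ∉ 𝒟.metric.chronologicalPast 𝒟.timeOrientation (γ '' (dom ∩ Set.Ici 0)))
  · exact (h.2 𝒟 h𝒟).2 hH
  · obtain ⟨O, d, hN, hO, hR, hE, hF⟩ := hA X D hD 𝒟 h𝒟 (h.2 𝒟 h𝒟).1 hH
    exact ⟨O, d, fun i ↦ (Fin.cast hN i).elim0, hO, hR, hE, hF⟩

/-- **Granted this route's rank-3 crux, the generic branch IS the summit**:
`CensoredHorizonlessDisperse → (GenericCensoredHolesSettle ↔ FinalStateConjecture)`. [folklore] -/
theorem genericCensoredHolesSettle_iff_finalStateConjecture (hA : CensoredHorizonlessDisperse) :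
    GenericCensoredHolesSettle ↔ _root_.FinalStateConjecture :=
  ⟨finalStateConjecture_of_censoredHorizonlessDisperse hA,
    genericCensoredHolesSettle_of_finalStateConjecture⟩

/-- **The crux from the two tame exits and MGHD existence, by name** (cross-route record:
BondiDrainDispersal rank 5 ⇐ stmt-9937 ∧ stmt-17383 ∧ stmt-17348, the deciding theorem of route
TangentProfileCensorship followed by the weakening to the crux). [folklore] -/
theorem genericCensoredHolesSettle_of_tameExits (hM : TangentProfileCensorship.MGHDExistence)
    (hA : TangentProfileCensorship.NakedDataTameExit)
    (hB : TangentProfileCensorship.CensoredDataTameExit) : GenericCensoredHolesSettle :=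
  genericCensoredHolesSettle_of_finalStateConjecture (TangentProfileCensorship.closes hM hA hB)

/-! ## §2 Stub 0 (`stub_mghdExists`, registered signature verbatim) -/

/-- **Stub 0 is item stmt-9937 verbatim** (`CurvatureOrSymmetry.MGHDExistence`, shared by the
`MGHDExistence` / `MGHDExists` items of the summit's routes). [folklore] -/
theorem stub_mghdExists_iff_mghdExistence :
    (∀ (X : Type) [TopologicalSpace X] [ChartedSpace Literature.Geometry.Lorentzian.E3 X] [IsManifold (𝓡 3) ((⊤ : ℕ∞) : WithTop ℕ∞) X] [T2Space X] [SecondCountableTopology X] [ConnectedSpace X], ∀ D ∈ Literature.Geometry.Lorentzian.admissibleVacuumData X, ∃ 𝒟 : Literature.Geometry.Lorentzian.VacuumCauchyDevelopment D, 𝒟.IsMaximal) ↔ CurvatureOrSymmetry.MGHDExistence :=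
  Iff.rfl

/-- **Stub 0 from the Choquet-Bruhat–Geroch named fact** (one line:
`choquetBruhat_geroch_exists_mghd_cauchy.forall_mem_admissibleVacuumData`). The stub is thereby
CONDITIONAL on the unproved tree fact; it closes when `choquetBruhat_geroch_exists_mghd_cauchy_holds`
lands. [cite: ChoquetBruhatGeroch1969CMP, Thm. 3 (p. 332)] -/
theorem stub_mghdExists_of_choquetBruhatGeroch (h : choquetBruhat_geroch_exists_mghd_cauchy) :
    ∀ (X : Type) [TopologicalSpace X] [ChartedSpace Literature.Geometry.Lorentzian.E3 X] [IsManifold (𝓡 3) ((⊤ : ℕ∞) : WithTop ℕ∞) X] [T2Space X] [SecondCountableTopology X] [ConnectedSpace X], ∀ D ∈ Literature.Geometry.Lorentzian.admissibleVacuumData X, ∃ 𝒟 : Literature.Geometry.Lorentzian.VacuumCauchyDevelopment D, 𝒟.IsMaximal :=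
  h.forall_mem_admissibleVacuumData

/-! ## §3 Stub 1 (`stub_weakCosmicCensorship`, registered signature verbatim) -/

/-- **Stub 1 from item stmt-17269** (`PhaseMixingCapture.WeakCosmicCensorshipTame`, which carries
the extra conjunct `∃ 𝒟, 𝒟.IsMaximal`): forget that conjunct (`IsTameChristodoulouGeneric.mono`).
[folklore] -/
theorem stub_weakCosmicCensorship_of_weakCosmicCensorshipTame
    (h : PhaseMixingCapture.WeakCosmicCensorshipTame) :
    ∀ (X : Type) [TopologicalSpace X] [ChartedSpace Literature.Geometry.Lorentzian.E3 X] [IsManifold (𝓡 3) ((⊤ : ℕ∞) : WithTop ℕ∞) X] [T2Space X] [SecondCountableTopology X] [ConnectedSpace X], Literature.Geometry.Lorentzian.InitialDataSet.IsTameChristodoulouGeneric (Literature.Geometry.Lorentzian.admissibleVacuumData X) (fun D ↦ ∀ 𝒟 : Literature.Geometry.Lorentzian.VacuumCauchyDevelopment D, 𝒟.IsMaximal → Summit.FinalStateConjecture.HasCompleteNullInfinity 𝒟.toCauchyDevelopment) 1 := by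
  intro X _ _ _ _ _ _
  exact (h X).mono fun D _ hP 𝒟 h𝒟 ↦ hP.2 𝒟 h𝒟

/-- **Stub 1 from item stmt-17383** (`TangentProfileCensorship.NakedDataTameExit`): an exceptional
datum of the censorship property has an MGHD with incomplete `𝓘⁺`, the exit supplies a tame
immersed injective admissible curve whose small members are good (in particular censored), and
locality of tame genericity (`isTameChristodoulouGeneric_of_local`) globalises. No MGHD-existence
hypothesis is needed. [folklore] -/
theorem stub_weakCosmicCensorship_of_nakedDataTameExit
    (h : TangentProfileCensorship.NakedDataTameExit) :
    ∀ (X : Type) [TopologicalSpace X] [ChartedSpace Literature.Geometry.Lorentzian.E3 X] [IsManifold (𝓡 3) ((⊤ : ℕ∞) : WithTop ℕ∞) X] [T2Space X] [SecondCountableTopology X] [ConnectedSpace X], Literature.Geometry.Lorentzian.InitialDataSet.IsTameChristodoulouGeneric (Literature.Geometry.Lorentzian.admissibleVacuumData X) (fun D ↦ ∀ 𝒟 : Literature.Geometry.Lorentzian.VacuumCauchyDevelopment D, 𝒟.IsMaximal → Summit.FinalStateConjecture.HasCompleteNullInfinity 𝒟.toCauchyDevelopment) 1 := by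
  intro X _ _ _ _ _ _
  refine InitialDataSet.isTameChristodoulouGeneric_of_local fun D hD hnot ↦ ?_
  have hV : ∃ 𝒟 : VacuumCauchyDevelopment D, 𝒟.IsMaximal ∧
      ¬ Summit.FinalStateConjecture.HasCompleteNullInfinity 𝒟.toCauchyDevelopment := by
    by_contra hV
    apply hnot
    intro 𝒟 h𝒟
    by_contra hI
    exact hV ⟨𝒟, h𝒟, hI⟩
  obtain ⟨e, F, hF, himm, h0, hinj, hadm, ε, hε, hgood⟩ := h X D hD hV
  exact ⟨e, F, hF, himm, h0, hinj, hadm, ε, hε, fun c hc hcε 𝒟 h𝒟 ↦ ((hgood c hc hcε).2 𝒟 h𝒟).1⟩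

/-! ## §4 Stub 2 (`stub_landing`, registered signature verbatim) -/

/-- **Stub 2 from item stmt-17383** (`TangentProfileCensorship.NakedDataTameExit`): the base datum
`F 0` of the given censored curve has an MGHD with incomplete `𝓘⁺`, so the exit at `F 0` supplies
the landing curve outright (the given curve, its end and its censoring are not used; goodness of
the exit members in the summit's sense implies the crux's "censored, and settles if it has a
horizon"). [folklore] -/
theorem stub_landing_of_nakedDataTameExit (h : TangentProfileCensorship.NakedDataTameExit) :
    ∀ (X : Type) [TopologicalSpace X] [ChartedSpace Literature.Geometry.Lorentzian.E3 X] [IsManifold (𝓡 3) ((⊤ : ℕ∞) : WithTop ℕ∞) X] [T2Space X] [SecondCountableTopology X] [ConnectedSpace X], ∀ (e : Literature.Geometry.Lorentzian.AFEnd X) (F : EuclideanSpace ℝ (Fin 1) → Literature.Geometry.Lorentzian.InitialDataSet (𝓡 3) X), Literature.Geometry.Lorentzian.InitialDataSet.IsTameDataFamily e 1 F → Literature.Geometry.Lorentzian.InitialDataSet.IsImmersedAtZero 1 F → Function.Injective F → (∀ c, F c ∈ Literature.Geometry.Lorentzian.admissibleVacuumData X) → (∃ 𝒟 : Literature.Geometry.Lorentzian.VacuumCauchyDevelopment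 (F 0), 𝒟.IsMaximal ∧ ¬ Summit.FinalStateConjecture.HasCompleteNullInfinity 𝒟.toCauchyDevelopment) → (∀ c ≠ 0, ∀ 𝒟 : Literature.Geometry.Lorentzian.VacuumCauchyDevelopment (F c), 𝒟.IsMaximal → Summit.FinalStateConjecture.HasCompleteNullInfinity 𝒟.toCauchyDevelopment) → ∃ (e' : Literature.Geometry.Lorentzian.AFEnd X) (F' : EuclideanSpace ℝ (Fin 1) → Literature.Geometry.Lorentzian.InitialDataSet (𝓡 3) X), Literature.Geometry.Lorentzian.InitialDataSet.IsTameDataFamily e' 1 F' ∧ Literature.Geometry.Lorentzian.InitialDataSet.IsImmersedAtZero 1 F' ∧ F' 0 = F 0 ∧ Function.Injective F' ∧ (∀ c, F' c ∈ Literature.Geometry.Lorentzian.admissibleVacuumData X) ∧ ∃ ε > (0 : ℝ), ∀ c, c ≠ 0 → ‖c‖ < ε → ∀ 𝒟 : Literature.Geometry.Lorentzian.VacuumCauchyDevelopment (F' c), 𝒟.IsMaximal → Summit.FinalStateConjecture.HasCompleteNullInfinity 𝒟.toCauchyDevelopment ∧ ((∀ [𝒟.metric.HasLeviCivita], ∃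 q : 𝒟.carrier, ∀ (p : X) (γ : ℝ → 𝒟.carrier) (dom : Set ℝ), 𝒟.metric.IsNormalisedNullRayFrom 𝒟.timeOrientation 𝒟.embed 𝒟.normal p γ dom → ¬ BddAbove dom → q ∉ 𝒟.metric.chronologicalPast 𝒟.timeOrientation (γ '' (dom ∩ Set.Ici 0))) → ∃ (O : Set 𝒟.carrier) (d : Literature.Geometry.Lorentzian.FinalStateDecomposition 𝒟.toSpacetime O 2), (∀ i, Literature.Geometry.Lorentzian.Kerr.IsSubextremal (d.mass i) (d.spin i)) ∧ O = Summit.FinalStateConjecture.exteriorOf 𝒟.toCauchyDevelopment d.charted ∧ Summit.FinalStateConjecture.RaysStayInClosure 𝒟.toCauchyDevelopment O ∧ Summit.FinalStateConjecture.HasExhaustiveCharts d ∧ Summit.FinalStateConjecture.IsFutureOriented d) := by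
  intro X _ _ _ _ _ _ e F _ _ _ hadm hV _
  obtain ⟨e', F', hF', himm', h0', hinj', hadm', ε, hε, hgood⟩ := h X (F 0) (hadm 0) hV
  refine ⟨e', F', hF', himm', h0', hinj', hadm', ε, hε, fun c hc hcε 𝒟 h𝒟 ↦ ?_⟩
  exact ⟨((hgood c hc hcε).2 𝒟 h𝒟).1, fun _ ↦ ((hgood c hc hcε).2 𝒟 h𝒟).2⟩

/-! ## §5 Stub 3 (`stub_thresholdEscape`, registered signature verbatim) -/

/-- **Stub 3 from item stmt-17348** (`TangentProfileCensorship.CensoredDataTameExit` =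
`CurvatureOrSymmetry.TameCensoredDataExit` verbatim): a censored datum with a maximal development
that has a horizon and does not settle is a censored datum with a non-settling MGHD (forget the
horizon); the exit members are good in the summit's sense, a fortiori in the crux's. [folklore] -/
theorem stub_thresholdEscape_of_tameCensoredDataExit
    (h : TangentProfileCensorship.CensoredDataTameExit) :
    ∀ (X : Type) [TopologicalSpace X] [ChartedSpace Literature.Geometry.Lorentzian.E3 X] [IsManifold (𝓡 3) ((⊤ : ℕ∞) : WithTop ℕ∞) X] [T2Space X] [SecondCountableTopology X] [ConnectedSpace X], ∀ D ∈ Literature.Geometry.Lorentzian.admissibleVacuumData X, (∀ 𝒟 : Literature.Geometry.Lorentzian.VacuumCauchyDevelopment D, 𝒟.IsMaximal → Summit.FinalStateConjecture.HasCompleteNullInfinity 𝒟.toCauchyDevelopment) → (∃ 𝒟 : Literature.Geometry.Lorentzian.VacuumCauchyDevelopment D, 𝒟.IsMaximal ∧ (∀ [𝒟.metric.HasLeviCivita], ∃ q : 𝒟.carrier, ∀ (p : X) (γ : ℝ → 𝒟.carrier) (dom : Set ℝ), 𝒟.metric.IsNormalisedNullRayFrom 𝒟.timeOrientation 𝒟.embed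 𝒟.normal p γ dom → ¬ BddAbove dom → q ∉ 𝒟.metric.chronologicalPast 𝒟.timeOrientation (γ '' (dom ∩ Set.Ici 0))) ∧ ¬ ∃ (O : Set 𝒟.carrier) (d : Literature.Geometry.Lorentzian.FinalStateDecomposition 𝒟.toSpacetime O 2), (∀ i, Literature.Geometry.Lorentzian.Kerr.IsSubextremal (d.mass i) (d.spin i)) ∧ O = Summit.FinalStateConjecture.exteriorOf 𝒟.toCauchyDevelopment d.charted ∧ Summit.FinalStateConjecture.RaysStayInClosure 𝒟.toCauchyDevelopment O ∧ Summit.FinalStateConjecture.HasExhaustiveCharts d ∧ Summit.FinalStateConjecture.IsFutureOriented d) → ∃ (e : Literature.Geometry.Lorentzian.AFEnd X) (F : EuclideanSpace ℝ (Fin 1) → Literature.Geometry.Lorentzian.InitialDataSet (𝓡 3) X), Literature.Geometry.Lorentzian.InitialDataSet.IsTameDataFamily e 1 F ∧ Literature.Geometry.Lorentzian.InitialDataSet.IsImmersedAtZero 1 F ∧ F 0 = D ∧ Function.Injective F ∧ (∀ c, F c ∈ Literature.Geometry.Lorentzian.admissibleVacuumData X) ∧ ∃ ε > (0 : ℝ),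 ∀ c, c ≠ 0 → ‖c‖ < ε → ∀ 𝒟 : Literature.Geometry.Lorentzian.VacuumCauchyDevelopment (F c), 𝒟.IsMaximal → Summit.FinalStateConjecture.HasCompleteNullInfinity 𝒟.toCauchyDevelopment ∧ ((∀ [𝒟.metric.HasLeviCivita], ∃ q : 𝒟.carrier, ∀ (p : X) (γ : ℝ → 𝒟.carrier) (dom : Set ℝ), 𝒟.metric.IsNormalisedNullRayFrom 𝒟.timeOrientation 𝒟.embed 𝒟.normal p γ dom → ¬ BddAbove dom → q ∉ 𝒟.metric.chronologicalPast 𝒟.timeOrientation (γ '' (dom ∩ Set.Ici 0))) → ∃ (O : Set 𝒟.carrier) (d : Literature.Geometry.Lorentzian.FinalStateDecomposition 𝒟.toSpacetime O 2), (∀ i, Literature.Geometry.Lorentzian.Kerr.IsSubextremal (d.mass i) (d.spin i)) ∧ O = Summit.FinalStateConjecture.exteriorOf 𝒟.toCauchyDevelopment d.charted ∧ Summit.FinalStateConjecture.RaysStayInClosure 𝒟.toCauchyDevelopment O ∧ Summit.FinalStateConjecture.HasExhaustiveCharts d ∧ Summit.FinalStateConjecture.IsFutureOriented d) := by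
  intro X _ _ _ _ _ _ D hD hC hT
  obtain ⟨𝒟₀, h𝒟₀, -, hS⟩ := hT
  obtain ⟨e, F, hF, himm, h0, hinj, hadm, ε, hε, hgood⟩ := h X D hD ⟨𝒟₀, h𝒟₀⟩ hC ⟨𝒟₀, h𝒟₀, hS⟩
  refine ⟨e, F, hF, himm, h0, hinj, hadm, ε, hε, fun c hc hcε 𝒟 h𝒟 ↦ ?_⟩
  exact ⟨((hgood c hc hcε).2 𝒟 h𝒟).1, fun _ ↦ ((hgood c hc hcε).2 𝒟 h𝒟).2⟩

/-- The same record against the CurvatureOrSymmetry spelling of item stmt-17348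
(`TameCensoredDataExit`, definitionally the TangentProfileCensorship decl). [folklore] -/
theorem stub_thresholdEscape_of_tameCensoredDataExit'
    (h : CurvatureOrSymmetry.TameCensoredDataExit) :
    ∀ (X : Type) [TopologicalSpace X] [ChartedSpace Literature.Geometry.Lorentzian.E3 X] [IsManifold (𝓡 3) ((⊤ : ℕ∞) : WithTop ℕ∞) X] [T2Space X] [SecondCountableTopology X] [ConnectedSpace X], ∀ D ∈ Literature.Geometry.Lorentzian.admissibleVacuumData X, (∀ 𝒟 : Literature.Geometry.Lorentzian.VacuumCauchyDevelopment D, 𝒟.IsMaximal → Summit.FinalStateConjecture.HasCompleteNullInfinity 𝒟.toCauchyDevelopment) → (∃ 𝒟 : Literature.Geometry.Lorentzian.VacuumCauchyDevelopment D, 𝒟.IsMaximal ∧ (∀ [𝒟.metric.HasLeviCivita], ∃ q : 𝒟.carrier, ∀ (p : X) (γ : ℝ → 𝒟.carrier) (dom : Set ℝ), 𝒟.metric.IsNormalisedNullRayFrom 𝒟.timeOrientation 𝒟.embed 𝒟.normal p γ dom → ¬ BddAbove dom → q ∉ 𝒟.metric.chronologicalPast 𝒟.timeOrientation (γ '' (dom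 ∩ Set.Ici 0))) ∧ ¬ ∃ (O : Set 𝒟.carrier) (d : Literature.Geometry.Lorentzian.FinalStateDecomposition 𝒟.toSpacetime O 2), (∀ i, Literature.Geometry.Lorentzian.Kerr.IsSubextremal (d.mass i) (d.spin i)) ∧ O = Summit.FinalStateConjecture.exteriorOf 𝒟.toCauchyDevelopment d.charted ∧ Summit.FinalStateConjecture.RaysStayInClosure 𝒟.toCauchyDevelopment O ∧ Summit.FinalStateConjecture.HasExhaustiveCharts d ∧ Summit.FinalStateConjecture.IsFutureOriented d) → ∃ (e : Literature.Geometry.Lorentzian.AFEnd X) (F : EuclideanSpace ℝ (Fin 1) → Literature.Geometry.Lorentzian.InitialDataSet (𝓡 3) X), Literature.Geometry.Lorentzian.InitialDataSet.IsTameDataFamily e 1 F ∧ Literature.Geometry.Lorentzian.InitialDataSet.IsImmersedAtZero 1 F ∧ F 0 = D ∧ Function.Injective F ∧ (∀ c, F c ∈ Literature.Geometry.Lorentzian.admissibleVacuumData X) ∧ ∃ ε > (0 : ℝ), ∀ c, c ≠ 0 → ‖c‖ < ε → ∀ 𝒟 : Literature.Geometry.Lorentzian.VacuumCauchyDevelopment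 (F c), 𝒟.IsMaximal → Summit.FinalStateConjecture.HasCompleteNullInfinity 𝒟.toCauchyDevelopment ∧ ((∀ [𝒟.metric.HasLeviCivita], ∃ q : 𝒟.carrier, ∀ (p : X) (γ : ℝ → 𝒟.carrier) (dom : Set ℝ), 𝒟.metric.IsNormalisedNullRayFrom 𝒟.timeOrientation 𝒟.embed 𝒟.normal p γ dom → ¬ BddAbove dom → q ∉ 𝒟.metric.chronologicalPast 𝒟.timeOrientation (γ '' (dom ∩ Set.Ici 0))) → ∃ (O : Set 𝒟.carrier) (d : Literature.Geometry.Lorentzian.FinalStateDecomposition 𝒟.toSpacetime O 2), (∀ i, Literature.Geometry.Lorentzian.Kerr.IsSubextremal (d.mass i) (d.spin i)) ∧ O = Summit.FinalStateConjecture.exteriorOf 𝒟.toCauchyDevelopment d.charted ∧ Summit.FinalStateConjecture.RaysStayInClosure 𝒟.toCauchyDevelopment O ∧ Summit.FinalStateConjecture.HasExhaustiveCharts d ∧ Summit.FinalStateConjecture.IsFutureOriented d) :=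
  stub_thresholdEscape_of_tameCensoredDataExit h

/-! ## §6 Converses GRANTED this route's rank-3 crux `CensoredHorizonlessDisperse` and MGHD
existence: modulo those two, stub 3 is item 17348 and stubs 1 + 2 are item 17383. -/

/-- **Upgrade "good in the crux's sense" to "good in the summit's sense"** on one admissible
datum, granted `CensoredHorizonlessDisperse` and an MGHD of the datum: if every MGHD is censored
and settles whenever it has a horizon, then every MGHD settles (a horizonless censored MGHD
disperses honestly, `N = 0`, sub-extremality vacuous over `Fin 0`). [folklore] -/
theorem good_of_isGood (hA : CensoredHorizonlessDisperse) {X : Type} [TopologicalSpace X]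
    [ChartedSpace E3 X] [IsManifold (𝓡 3) ∞ X] [T2Space X] [SecondCountableTopology X]
    [ConnectedSpace X] {D : InitialDataSet (𝓡 3) X} (hD : D ∈ admissibleVacuumData X)
    (hM : ∃ 𝒟 : VacuumCauchyDevelopment D, 𝒟.IsMaximal)
    (hgood : ∀ 𝒟 : VacuumCauchyDevelopment D, 𝒟.IsMaximal →
      Summit.FinalStateConjecture.HasCompleteNullInfinity 𝒟.toCauchyDevelopment ∧
        ((∀ [𝒟.metric.HasLeviCivita], ∃ q : 𝒟.carrier, ∀ (p : X) (γ : ℝ → 𝒟.carrier)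
            (dom : Set ℝ), 𝒟.metric.IsNormalisedNullRayFrom 𝒟.timeOrientation 𝒟.embed 𝒟.normal p
              γ dom → ¬ BddAbove dom →
              q ∉ 𝒟.metric.chronologicalPast 𝒟.timeOrientation (γ '' (dom ∩ Set.Ici 0))) →
          ∃ (O : Set 𝒟.carrier) (d : FinalStateDecomposition 𝒟.toSpacetime O 2),
            (∀ i, Kerr.IsSubextremal (d.mass i) (d.spin i)) ∧
              O = Summit.FinalStateConjecture.exteriorOf 𝒟.toCauchyDevelopment d.charted ∧
                Summit.FinalStateConjecture.RaysStayInClosure 𝒟.toCauchyDevelopment O ∧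
                  Summit.FinalStateConjecture.HasExhaustiveCharts d ∧
                    Summit.FinalStateConjecture.IsFutureOriented d)) :
    (∃ 𝒟 : VacuumCauchyDevelopment D, 𝒟.IsMaximal) ∧
      ∀ 𝒟 : VacuumCauchyDevelopment D, 𝒟.IsMaximal →
        Summit.FinalStateConjecture.HasCompleteNullInfinity 𝒟.toCauchyDevelopment ∧
          ∃ (O : Set 𝒟.carrier) (d : FinalStateDecomposition 𝒟.toSpacetime O 2),
            (∀ i, Kerr.IsSubextremal (d.mass i) (d.spin i)) ∧
              O = Summit.FinalStateConjecture.exteriorOf 𝒟.toCauchyDevelopment d.charted ∧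
                Summit.FinalStateConjecture.RaysStayInClosure 𝒟.toCauchyDevelopment O ∧
                  Summit.FinalStateConjecture.HasExhaustiveCharts d ∧
                    Summit.FinalStateConjecture.IsFutureOriented d := by
  refine ⟨hM, fun 𝒟 h𝒟 ↦ ⟨(hgood 𝒟 h𝒟).1, ?_⟩⟩
  by_cases hH : (∀ [𝒟.metric.HasLeviCivita], ∃ q : 𝒟.carrier, ∀ (p : X) (γ : ℝ → 𝒟.carrier)
      (dom : Set ℝ), 𝒟.metric.IsNormalisedNullRayFrom 𝒟.timeOrientation 𝒟.embed 𝒟.normal p γ dom →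
      ¬ BddAbove dom → q ∉ 𝒟.metric.chronologicalPast 𝒟.timeOrientation (γ '' (dom ∩ Set.Ici 0)))
  · exact (hgood 𝒟 h𝒟).2 hH
  · obtain ⟨O, d, hN, hO, hR, hE, hF⟩ := hA X D hD 𝒟 h𝒟 (hgood 𝒟 h𝒟).1 hH
    exact ⟨O, d, fun i ↦ (Fin.cast hN i).elim0, hO, hR, hE, hF⟩

/-- **Item stmt-17348 from stub 3, GRANTED `CensoredHorizonlessDisperse` and MGHD existence**:
a censored datum with a non-settling MGHD `𝒟₀` — that MGHD has a horizon (else it would disperse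
honestly and settle with `N = 0`), so stub 3 gives the curve, and `good_of_isGood` upgrades its
members. With `stub_thresholdEscape_of_tameCensoredDataExit`: modulo this route's rank-3 crux and
the CBG fact, the line's threshold stub IS item 17348. [folklore] -/
theorem tameCensoredDataExit_of_stub_thresholdEscape (hA : CensoredHorizonlessDisperse)
    (hM : TangentProfileCensorship.MGHDExistence)
    (h₃ : ∀ (X : Type) [TopologicalSpace X] [ChartedSpace Literature.Geometry.Lorentzian.E3 X] [IsManifold (𝓡 3) ((⊤ : ℕ∞) : WithTop ℕ∞) X] [T2Space X] [SecondCountableTopology X] [ConnectedSpace X], ∀ D ∈ Literature.Geometry.Lorentzian.admissibleVacuumData X, (∀ 𝒟 : Literature.Geometry.Lorentzian.VacuumCauchyDevelopment D, 𝒟.IsMaximal → Summit.FinalStateConjecture.HasCompleteNullInfinity 𝒟.toCauchyDevelopment) → (∃ 𝒟 : Literature.Geometry.Lorentzian.VacuumCauchyDevelopment D, 𝒟.IsMaximal ∧ (∀ [𝒟.metric.HasLeviCivita], ∃ q : 𝒟.carrier, ∀ (p : X) (γ : ℝ → 𝒟.carrier) (dom : Set ℝ), 𝒟.metric.IsNormalisedNullRayFrom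 𝒟.timeOrientation 𝒟.embed 𝒟.normal p γ dom → ¬ BddAbove dom → q ∉ 𝒟.metric.chronologicalPast 𝒟.timeOrientation (γ '' (dom ∩ Set.Ici 0))) ∧ ¬ ∃ (O : Set 𝒟.carrier) (d : Literature.Geometry.Lorentzian.FinalStateDecomposition 𝒟.toSpacetime O 2), (∀ i, Literature.Geometry.Lorentzian.Kerr.IsSubextremal (d.mass i) (d.spin i)) ∧ O = Summit.FinalStateConjecture.exteriorOf 𝒟.toCauchyDevelopment d.charted ∧ Summit.FinalStateConjecture.RaysStayInClosure 𝒟.toCauchyDevelopment O ∧ Summit.FinalStateConjecture.HasExhaustiveCharts d ∧ Summit.FinalStateConjecture.IsFutureOriented d) → ∃ (e : Literature.Geometry.Lorentzian.AFEnd X) (F : EuclideanSpace ℝ (Fin 1) → Literature.Geometry.Lorentzian.InitialDataSet (𝓡 3) X), Literature.Geometry.Lorentzian.InitialDataSet.IsTameDataFamily e 1 F ∧ Literature.Geometry.Lorentzian.InitialDataSet.IsImmersedAtZero 1 F ∧ F 0 = D ∧ Function.Injective F ∧ (∀ c, F c ∈ Literature.Geometry.Lorentzian.admissibleVacuumData X)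 ∧ ∃ ε > (0 : ℝ), ∀ c, c ≠ 0 → ‖c‖ < ε → ∀ 𝒟 : Literature.Geometry.Lorentzian.VacuumCauchyDevelopment (F c), 𝒟.IsMaximal → Summit.FinalStateConjecture.HasCompleteNullInfinity 𝒟.toCauchyDevelopment ∧ ((∀ [𝒟.metric.HasLeviCivita], ∃ q : 𝒟.carrier, ∀ (p : X) (γ : ℝ → 𝒟.carrier) (dom : Set ℝ), 𝒟.metric.IsNormalisedNullRayFrom 𝒟.timeOrientation 𝒟.embed 𝒟.normal p γ dom → ¬ BddAbove dom → q ∉ 𝒟.metric.chronologicalPast 𝒟.timeOrientation (γ '' (dom ∩ Set.Ici 0))) → ∃ (O : Set 𝒟.carrier) (d : Literature.Geometry.Lorentzian.FinalStateDecomposition 𝒟.toSpacetime O 2), (∀ i, Literature.Geometry.Lorentzian.Kerr.IsSubextremal (d.mass i) (d.spin i)) ∧ O = Summit.FinalStateConjecture.exteriorOf 𝒟.toCauchyDevelopment d.charted ∧ Summit.FinalStateConjecture.RaysStayInClosure 𝒟.toCauchyDevelopment O ∧ Summit.FinalStateConjecture.HasExhaustiveCharts d ∧ Summit.FinalStateConjecture.IsFutureOriented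 d)) :
    TangentProfileCensorship.CensoredDataTameExit := by
  intro X _ _ _ _ _ _ D hD _ hC hns
  obtain ⟨𝒟₀, h𝒟₀, hS⟩ := hns
  -- the non-settling censored MGHD has a horizon: otherwise it disperses honestly (`N = 0`)
  have hH : ∀ [𝒟₀.metric.HasLeviCivita], ∃ q : 𝒟₀.carrier, ∀ (p : X) (γ : ℝ → 𝒟₀.carrier)
      (dom : Set ℝ), 𝒟₀.metric.IsNormalisedNullRayFrom 𝒟₀.timeOrientation 𝒟₀.embed 𝒟₀.normal p γ
        dom → ¬ BddAbove dom →
        q ∉ 𝒟₀.metric.chronologicalPast 𝒟₀.timeOrientation (γ '' (dom ∩ Set.Ici 0)) := by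
    by_contra hH
    obtain ⟨O, d, hN, hO, hR, hE, hF⟩ := hA X D hD 𝒟₀ h𝒟₀ (hC 𝒟₀ h𝒟₀) hH
    exact hS ⟨O, d, fun i ↦ (Fin.cast hN i).elim0, hO, hR, hE, hF⟩
  obtain ⟨e, F, hF, himm, h0, hinj, hadm, ε, hε, hgood⟩ := h₃ X D hD hC ⟨𝒟₀, h𝒟₀, hH, hS⟩
  exact ⟨e, F, hF, himm, h0, hinj, hadm, ε, hε,
    fun c hc hcε ↦ good_of_isGood hA (hadm c) (hM X (F c) (hadm c)) (hgood c hc hcε)⟩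

/-- **Item stmt-17383 from stubs 1 + 2, GRANTED `CensoredHorizonlessDisperse` and MGHD
existence**: a datum with an MGHD of incomplete `𝓘⁺` is exceptional for censorship, so stub 1's
genericity witness is a tame immersed injective admissible curve through it whose members off `0`
are censored; stub 2 lands along it; `good_of_isGood` upgrades the members. With
`stub_weakCosmicCensorship_of_nakedDataTameExit` and `stub_landing_of_nakedDataTameExit`: modulo
this route's rank-3 crux and the CBG fact, the line's violating-stratum pair IS item 17383. [folklore] -/
theorem nakedDataTameExit_of_stub_weakCosmicCensorship_of_stub_landing
    (hA : CensoredHorizonlessDisperse) (hM : TangentProfileCensorship.MGHDExistence)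
    (h₁ : ∀ (X : Type) [TopologicalSpace X] [ChartedSpace Literature.Geometry.Lorentzian.E3 X] [IsManifold (𝓡 3) ((⊤ : ℕ∞) : WithTop ℕ∞) X] [T2Space X] [SecondCountableTopology X] [ConnectedSpace X], Literature.Geometry.Lorentzian.InitialDataSet.IsTameChristodoulouGeneric (Literature.Geometry.Lorentzian.admissibleVacuumData X) (fun D ↦ ∀ 𝒟 : Literature.Geometry.Lorentzian.VacuumCauchyDevelopment D, 𝒟.IsMaximal → Summit.FinalStateConjecture.HasCompleteNullInfinity 𝒟.toCauchyDevelopment) 1)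
    (h₂ : ∀ (X : Type) [TopologicalSpace X] [ChartedSpace Literature.Geometry.Lorentzian.E3 X] [IsManifold (𝓡 3) ((⊤ : ℕ∞) : WithTop ℕ∞) X] [T2Space X] [SecondCountableTopology X] [ConnectedSpace X], ∀ (e : Literature.Geometry.Lorentzian.AFEnd X) (F : EuclideanSpace ℝ (Fin 1) → Literature.Geometry.Lorentzian.InitialDataSet (𝓡 3) X), Literature.Geometry.Lorentzian.InitialDataSet.IsTameDataFamily e 1 F → Literature.Geometry.Lorentzian.InitialDataSet.IsImmersedAtZero 1 F → Function.Injective F → (∀ c, F c ∈ Literature.Geometry.Lorentzian.admissibleVacuumData X) → (∃ 𝒟 : Literature.Geometry.Lorentzian.VacuumCauchyDevelopment (F 0), 𝒟.IsMaximal ∧ ¬ Summit.FinalStateConjecture.HasCompleteNullInfinity 𝒟.toCauchyDevelopment) → (∀ c ≠ 0, ∀ 𝒟 : Literature.Geometry.Lorentzian.VacuumCauchyDevelopment (F c), 𝒟.IsMaximal → Summit.FinalStateConjecture.HasCompleteNullInfinity 𝒟.toCauchyDevelopment) → ∃ (e' : Literature.Geometry.Lorentzian.AFEnd X) (F' : EuclideanSpace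 ℝ (Fin 1) → Literature.Geometry.Lorentzian.InitialDataSet (𝓡 3) X), Literature.Geometry.Lorentzian.InitialDataSet.IsTameDataFamily e' 1 F' ∧ Literature.Geometry.Lorentzian.InitialDataSet.IsImmersedAtZero 1 F' ∧ F' 0 = F 0 ∧ Function.Injective F' ∧ (∀ c, F' c ∈ Literature.Geometry.Lorentzian.admissibleVacuumData X) ∧ ∃ ε > (0 : ℝ), ∀ c, c ≠ 0 → ‖c‖ < ε → ∀ 𝒟 : Literature.Geometry.Lorentzian.VacuumCauchyDevelopment (F' c), 𝒟.IsMaximal → Summit.FinalStateConjecture.HasCompleteNullInfinity 𝒟.toCauchyDevelopment ∧ ((∀ [𝒟.metric.HasLeviCivita], ∃ q : 𝒟.carrier, ∀ (p : X) (γ : ℝ → 𝒟.carrier) (dom : Set ℝ), 𝒟.metric.IsNormalisedNullRayFrom 𝒟.timeOrientation 𝒟.embed 𝒟.normal p γ dom → ¬ BddAbove dom → q ∉ 𝒟.metric.chronologicalPast 𝒟.timeOrientation (γ '' (dom ∩ Set.Ici 0))) → ∃ (O : Set 𝒟.carrier) (d : Literature.Geometry.Lorentzian.FinalStateDecomposition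 𝒟.toSpacetime O 2), (∀ i, Literature.Geometry.Lorentzian.Kerr.IsSubextremal (d.mass i) (d.spin i)) ∧ O = Summit.FinalStateConjecture.exteriorOf 𝒟.toCauchyDevelopment d.charted ∧ Summit.FinalStateConjecture.RaysStayInClosure 𝒟.toCauchyDevelopment O ∧ Summit.FinalStateConjecture.HasExhaustiveCharts d ∧ Summit.FinalStateConjecture.IsFutureOriented d)) :
    TangentProfileCensorship.NakedDataTameExit := by
  intro X _ _ _ _ _ _ D hD hV
  have hnot : ¬ ∀ 𝒟 : VacuumCauchyDevelopment D, 𝒟.IsMaximal →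
      Summit.FinalStateConjecture.HasCompleteNullInfinity 𝒟.toCauchyDevelopment := by
    obtain ⟨𝒟, h𝒟, hI⟩ := hV
    exact fun h ↦ hI (h 𝒟 h𝒟)
  obtain ⟨e, F, hF, himm, h0, hinj, hadm, hE⟩ := h₁ X D ⟨hD, hnot⟩
  have hcens : ∀ c ≠ 0, ∀ 𝒟 : VacuumCauchyDevelopment (F c), 𝒟.IsMaximal →
      Summit.FinalStateConjecture.HasCompleteNullInfinity 𝒟.toCauchyDevelopment := by
    intro c hc 𝒟 h𝒟
    by_contra hI
    exact hE c hc ⟨hadm c, fun h ↦ hI (h 𝒟 h𝒟)⟩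
  subst h0
  obtain ⟨e', F', hF', himm', h0', hinj', hadm', ε, hε, hgood⟩ := h₂ X e F hF himm hinj hadm hV hcens
  exact ⟨e', F', hF', himm', h0', hinj', hadm', ε, hε,
    fun c hc hcε ↦ good_of_isGood hA (hadm' c) (hM X (F' c) (hadm' c)) (hgood c hc hcε)⟩

/-! ## §7 (appended) The two exits are themselves weakenings of the summit; hence, GRANTED this
route's rank-3 crux and MGHD existence, the crux IS the conjunction of items 17383 and 17348. -/

/-- **Item stmt-17383 from the summit**: a datum with an MGHD of incomplete `𝓘⁺` is exceptional for
the summit's property, whose tame genericity hands over a (global) good curve; `ε = 1`. [folklore] -/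
theorem nakedDataTameExit_of_finalStateConjecture (h : _root_.FinalStateConjecture) :
    TangentProfileCensorship.NakedDataTameExit := by
  intro X _ _ _ _ _ _ D hD hV
  obtain ⟨𝒟₀, h𝒟₀, hI⟩ := hV
  obtain ⟨e, F, hF, himm, h0, hinj, hadm, hgood⟩ := h X D ⟨hD, fun hP ↦ hI (hP.2 𝒟₀ h𝒟₀).1⟩
  refine ⟨e, F, hF, himm, h0, hinj, hadm, 1, one_pos, fun c hc _ ↦ ?_⟩
  by_contra hP
  exact hgood c hc ⟨hadm c, hP⟩

/-- **Item stmt-17348 from the summit**: a censored datum with a non-settling MGHD is exceptional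
for the summit's property; `ε = 1`. [folklore] -/
theorem censoredDataTameExit_of_finalStateConjecture (h : _root_.FinalStateConjecture) :
    TangentProfileCensorship.CensoredDataTameExit := by
  intro X _ _ _ _ _ _ D hD _ _ hns
  obtain ⟨𝒟₀, h𝒟₀, hS⟩ := hns
  obtain ⟨e, F, hF, himm, h0, hinj, hadm, hgood⟩ := h X D ⟨hD, fun hP ↦ hS (hP.2 𝒟₀ h𝒟₀).2⟩
  refine ⟨e, F, hF, himm, h0, hinj, hadm, 1, one_pos, fun c hc _ ↦ ?_⟩
  by_contra hP
  exact hgood c hc ⟨hadm c, hP⟩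

/-- **The crux IS the two TangentProfileCensorship exits, granted this route's rank-3 crux and MGHD
existence**: `CensoredHorizonlessDisperse → MGHDExistence → (GenericCensoredHolesSettle ↔
NakedDataTameExit ∧ CensoredDataTameExit)`. Forward: the crux and `CensoredHorizonlessDisperse` give
the summit (`finalStateConjecture_of_censoredHorizonlessDisperse`), of which both exits are
weakenings; backward: `genericCensoredHolesSettle_of_tameExits` (MGHD existence used only here). So
the item stmt-17285 is closed by name the moment items 9937, 17383, 17348 are, and — modulo the
route's own rank-3 crux — asks for nothing less. [folklore] -/
theorem genericCensoredHolesSettle_iff_tameExits (hA : CensoredHorizonlessDisperse)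
    (hM : TangentProfileCensorship.MGHDExistence) :
    GenericCensoredHolesSettle ↔
      TangentProfileCensorship.NakedDataTameExit ∧ TangentProfileCensorship.CensoredDataTameExit :=
  ⟨fun hG ↦
    ⟨nakedDataTameExit_of_finalStateConjecture (finalStateConjecture_of_censoredHorizonlessDisperse hA hG),
      censoredDataTameExit_of_finalStateConjecture
        (finalStateConjecture_of_censoredHorizonlessDisperse hA hG)⟩,
    fun h ↦ genericCensoredHolesSettle_of_tameExits hM h.1 h.2⟩

end Summit.FinalStateConjecture.FinalStateConjecture.Theorems.BondiDrainDispersalGenericCensoredHolesSettle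

end
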